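import Summits.ABC.IUTFork.Joshi.ArithTeichmullerSpace2Proofs
import Mathlib.NumberTheory.Padics.Hensel
import Mathlib.NumberTheory.Padics.RingHoms
import Mathlib.FieldTheory.Finite.Basic
import HarnessLib

/-!
# Joshi, *Arithmetic Teichmüller Spaces I* (arXiv 2106.11452 v4) Lem. 10.8.3 — the typed exact sequence
# `1 → μ_{p^∞} → (1 + 𝔪) → 𝒪^{×μ} → 1` HOLDS IN FULL for `K = ℚ_p` (Teichmüller decomposition via Hensel's lemma)

Record/proof file of the abc-iut cell, branch E (seat abc-iut-E-t25; rung LADDER-ABC:A2.E; «authors first» non-vacuity /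
DERIVABLE row of the own claim-Prop `ATS1.Lem1083` of `Joshi/ArithTeichmullerSpace2.lean`, p430524). TAKES NO SIDE on [IUTchIII]
Cor. 3.12 or on any author. Source: K. Joshi, arXiv 2106.11452 v4, Lem. 10.8.3 p.51 l.38 – p.52 l.6 (render
`book:anonnd-2106-11452v4`); its surjectivity half is the Teichmüller decomposition «`𝒪^*_{ℚ̄_p} = μ′(ℚ̄_p) × (1 + 𝔪_{ℚ̄_p})`»
(p.51 l.49 – p.52 l.1).

`ArithTeichmullerSpace2Proofs` (p433707) proved the kernel clause for every ultrametric `K` with `‖p‖ < 1` and reduced the claim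
`Lem1083 K p` to the SURJECTIVITY of `(1 + 𝔪_K) → 𝒪^{×μ}_K`. HERE that surjectivity is PROVED for `K = ℚ_p` — so the typed Prop is
TRUE in the base case (`lem1083_padic : Lem1083 ℚ_[p] p`), in particular satisfiable/non-vacuous; Joshi's own case `K = ℚ̄_p` needs
the same Teichmüller step inside every finite extension of `ℚ_p` (Hensel for `𝒪_L`, not available in Mathlib beyond `ℤ_p`) and
stays the open half of `Lem1083 (PadicAlgCl p) p`. Ingredients (all Mathlib): `ringOfIntegers ℚ_[p] ≃+* ℤ_[p]` (same carrier
`{‖x‖ ≤ 1}`), Fermat in the residue field (`PadicInt.toZMod`, `ZMod.pow_card_sub_one_eq_one`) giving `‖a^{p-1} − 1‖ < 1` for a unit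
`a`, `‖p − 1‖ = 1`, and `PadicInt.hensels_lemma` for `X^{p-1} − 1` (TEICHMÜLLER representative `ω ≡ a mod p`, `ω^{p-1} = 1`); then
`a = ω · (ω⁻¹ a)` with `ω` torsion and `ω⁻¹ a` a principal unit.
-/

noncomputable section

namespace Summit.ABC.IUTFork.Joshi.ATS1

open Polynomial

variable (p : ℕ) [hp : Fact p.Prime]

/-- `𝒪_{ℚ_p}` in the sense of `ringOfIntegers` (closed unit ball as a subring) IS Mathlib's `ℤ_[p]` (same carrier). [folklore] -/
def ringOfIntegersPadicEquiv : ringOfIntegers ℚ_[p] ≃+* ℤ_[p] where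
  toFun x := ⟨x, (mem_ringOfIntegers_iff (x : ℚ_[p])).1 x.2⟩
  invFun z := ⟨z, (mem_ringOfIntegers_iff (z : ℚ_[p])).2 z.2⟩
  left_inv _ := rfl
  right_inv _ := rfl
  map_mul' _ _ := rfl
  map_add' _ _ := rfl

/-- The identification is the identity on `ℚ_p`. [folklore] -/
@[simp] theorem coe_ringOfIntegersPadicEquiv (x : ringOfIntegers ℚ_[p]) :
    ((ringOfIntegersPadicEquiv p x : ℤ_[p]) : ℚ_[p]) = (x : ℚ_[p]) := rfl

/-- … and so is its inverse. [folklore] -/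
@[simp] theorem coe_ringOfIntegersPadicEquiv_symm (z : ℤ_[p]) :
    (((ringOfIntegersPadicEquiv p).symm z : ringOfIntegers ℚ_[p]) : ℚ_[p]) = (z : ℚ_[p]) := rfl

/-- `‖p - 1‖ = 1` in `ℤ_p`. [folklore] -/
theorem norm_pred_p : ‖((p - 1 : ℕ) : ℤ_[p])‖ = 1 := by
  apply le_antisymm (PadicInt.norm_le_one _)
  by_contra hlt
  rw [not_le] at hlt
  have h : (p : ℤ) ∣ ((p - 1 : ℕ) : ℤ) := by
    rw [← PadicInt.norm_int_lt_one_iff_dvd]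
    simpa only [Int.cast_natCast] using hlt
  rw [Int.natCast_dvd_natCast] at h
  exact Nat.not_dvd_of_pos_of_lt (by have := hp.1.two_le; omega) (Nat.sub_lt hp.1.pos one_pos) h

/-- A unit of `ℤ_p` satisfies `‖a^{p-1} − 1‖ < 1` (Fermat in the residue field `𝔽_p`). [folklore] -/
theorem norm_pow_pred_sub_one_lt (a : ℤ_[p]) (ha : IsUnit a) : ‖a ^ (p - 1) - 1‖ < 1 := by
  have hbar : PadicInt.toZMod a ≠ 0 := (ha.map PadicInt.toZMod).ne_zero
  have hker : a ^ (p - 1) - 1 ∈ RingHom.ker (PadicInt.toZMod : ℤ_[p] →+* ZMod p) := by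
    rw [RingHom.mem_ker, map_sub, map_pow, map_one, ZMod.pow_card_sub_one_eq_one hbar, sub_self]
  rw [PadicInt.ker_toZMod, IsLocalRing.mem_maximalIdeal] at hker
  exact PadicInt.mem_nonunits.1 hker

/-- **Teichmüller representatives in `ℤ_p`** (Hensel's lemma for `X^{p-1} − 1`): every unit `a` of `ℤ_p` is congruent
`mod p` to a `(p-1)`-st root of unity `ω`. [folklore] -/
theorem exists_teichmuller (a : ℤ_[p]) (ha : IsUnit a) : ∃ ω : ℤ_[p], ω ^ (p - 1) = 1 ∧ ‖ω - a‖ < 1 := by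
  have ha1 : ‖a‖ = 1 := PadicInt.isUnit_iff.1 ha
  let F : Polynomial ℤ := X ^ (p - 1) - 1
  have haeval : ∀ z : ℤ_[p], F.aeval z = z ^ (p - 1) - 1 := fun z => by simp [F]
  have hderiv : ∀ z : ℤ_[p], F.derivative.aeval z = ((p - 1 : ℕ) : ℤ_[p]) * z ^ (p - 1 - 1) := fun z => by
    simp [F, derivative_X_pow]
  have hda : ‖F.derivative.aeval a‖ = 1 := by
    rw [hderiv, norm_mul, norm_pow, ha1, one_pow, mul_one, norm_pred_p]
  have hnorm : ‖F.aeval a‖ < ‖F.derivative.aeval a‖ ^ 2 := by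
    rw [hda, one_pow, haeval]
    exact norm_pow_pred_sub_one_lt p a ha
  obtain ⟨ω, hω0, hωa, -, -⟩ := hensels_lemma hnorm
  refine ⟨ω, ?_, ?_⟩
  · rw [haeval] at hω0
    exact sub_eq_zero.1 hω0
  · rw [hda] at hωa
    exact hωa

/-- **Lem. 10.8.3 holds in full for `K = ℚ_p`**: `(1 + pℤ_p) → ℤ_p^×/μ` is SURJECTIVE (every unit is a root of unity times a
principal unit — Teichmüller decomposition `ℤ_p^× = μ_{p-1} × (1 + pℤ_p)`), hence Joshi's typed exact sequence `Lem1083 ℚ_[p] p`.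
[folklore] -/
theorem principalUnitsToModTorsion_padic_surjective : Function.Surjective (principalUnitsToModTorsion ℚ_[p]) := by
  intro q
  induction q using QuotientGroup.induction_on with
  | H u =>
    have hp1 : p - 1 ≠ 0 := by have := hp.1.two_le; omega
    let e := ringOfIntegersPadicEquiv p
    have hu : IsUnit (e (u : ringOfIntegers ℚ_[p])) := (Units.isUnit u).map e
    obtain ⟨ω, hω1, hωa⟩ := exists_teichmuller p _ hu
    -- `ω` as an element / unit of `ringOfIntegers ℚ_[p]`
    let ω' : ringOfIntegers ℚ_[p] := e.symm ω
    have hω' : ω' ^ (p - 1) = 1 := by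
      change e.symm ω ^ (p - 1) = 1
      rw [← map_pow, hω1, map_one]
    let ζ : (ringOfIntegers ℚ_[p])ˣ := Units.ofPowEqOne ω' (p - 1) hω' hp1
    have hζval : ((ζ : (ringOfIntegers ℚ_[p])ˣ) : ringOfIntegers ℚ_[p]) = ω' := rfl
    have hζtor : ζ ∈ CommGroup.torsion (ringOfIntegers ℚ_[p])ˣ := by
      refine (CommGroup.mem_torsion _).2 (isOfFinOrder_iff_pow_eq_one.2 ⟨p - 1, Nat.pos_of_ne_zero hp1, ?_⟩)
      ext
      rw [Units.val_pow_eq_pow_val, hζval, hω', Units.val_one]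
    -- norms in `ℚ_p`
    have hωK : ((ω' : ringOfIntegers ℚ_[p]) : ℚ_[p]) = (ω : ℚ_[p]) := rfl
    have huK : ((e (u : ringOfIntegers ℚ_[p]) : ℤ_[p]) : ℚ_[p]) = ((u : ringOfIntegers ℚ_[p]) : ℚ_[p]) := rfl
    have hω_norm : ‖(ω : ℚ_[p])‖ = 1 := by
      have h := congrArg (fun z : ℤ_[p] => ‖(z : ℚ_[p])‖) hω1
      simp only [PadicInt.coe_pow, norm_pow, PadicInt.coe_one, norm_one] at h
      exact (pow_eq_one_iff_of_nonneg (norm_nonneg _) hp1).1 h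
    have hω_ne : (ω : ℚ_[p]) ≠ 0 := fun h => by rw [h, norm_zero] at hω_norm; exact zero_ne_one hω_norm
    have hdist : ‖((u : ringOfIntegers ℚ_[p]) : ℚ_[p]) - (ω : ℚ_[p])‖ < 1 := by
      have h := hωa
      rw [norm_sub_rev, PadicInt.norm_def, PadicInt.coe_sub] at h
      exact h
    -- the principal unit `ζ⁻¹ u`
    have hmul : (((ζ⁻¹ : (ringOfIntegers ℚ_[p])ˣ) : ringOfIntegers ℚ_[p]) : ℚ_[p]) * (ω : ℚ_[p]) = 1 := by
      rw [← hωK, ← hζval, ← Subring.coe_mul, ← Units.val_mul, inv_mul_cancel, Units.val_one, Subring.coe_one]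
    have hinvK : (((ζ⁻¹ : (ringOfIntegers ℚ_[p])ˣ) : ringOfIntegers ℚ_[p]) : ℚ_[p]) = (ω : ℚ_[p])⁻¹ :=
      eq_inv_of_mul_eq_one_left hmul
    have hv : ζ⁻¹ * u ∈ principalUnits ℚ_[p] := by
      change ‖(((ζ⁻¹ * u : (ringOfIntegers ℚ_[p])ˣ) : ringOfIntegers ℚ_[p]) : ℚ_[p]) - 1‖ < 1
      rw [Units.val_mul, Subring.coe_mul, hinvK]
      have : (ω : ℚ_[p])⁻¹ * ((u : ringOfIntegers ℚ_[p]) : ℚ_[p]) - 1 =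
          (ω : ℚ_[p])⁻¹ * (((u : ringOfIntegers ℚ_[p]) : ℚ_[p]) - (ω : ℚ_[p])) := by
        rw [mul_sub, inv_mul_cancel₀ hω_ne]
      rw [this, norm_mul, norm_inv, hω_norm, inv_one, one_mul]
      exact hdist
    refine ⟨⟨ζ⁻¹ * u, hv⟩, ?_⟩
    change QuotientGroup.mk' _ (ζ⁻¹ * u) = QuotientGroup.mk' _ u
    rw [QuotientGroup.mk'_apply, QuotientGroup.mk'_apply, QuotientGroup.eq, mul_inv_rev, inv_inv, mul_comm u⁻¹ ζ,
      inv_mul_cancel_right]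
    exact hζtor

/-- **`Lem1083 ℚ_[p] p` holds** — Joshi's Lem. 10.8.3 exact sequence, as typed, is TRUE for `K = ℚ_p` (non-vacuity / base
case of the claim-Prop; Joshi's own case `K = ℚ̄_p` needs the same Teichmüller step in every finite extension). [folklore] -/
theorem lem1083_padic : Lem1083 ℚ_[p] p :=
  (lem1083_iff_surjective ℚ_[p] p (by simpa using Padic.norm_p_lt_one (p := p))).2
    (principalUnitsToModTorsion_padic_surjective p)

end Summit.ABC.IUTFork.Joshi.ATS1

end
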